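import Summits.ResolutionOfSingularities.ResolutionOfSingularities.Theorems.HomologicalConductorNoZenoRLipman131Rational
import Literature.AlgebraicGeometry.Resolution.RationalResolutionSubschemeH1Vanishing
import HarnessLib

/-!
# Crux `NoZenoR` (stmt-ResolutionOfSingularities-19943) — `H¹(𝒪_Z) = 0` for every closed subscheme `Z` of every
# desingularization of a rational surface singularity, UNCONDITIONAL (the `χ = h⁰` dictionary of Lipman §27)

Route `ResolutionOfSingularities/HomologicalConductor` (cell decomp-res, hand leafhand-res-homologicalconduct-18 g0).
OURS: AI-written bookkeeping over tree theorems, weaker than expert review; nothing here is a statement of the manuscript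
under review (Hironaka 2017).  SUPPORT level, counted 0.  Def-free, no new named facts.

The Literature theorem `hasTrivialCechH1_subschemeι_comp_of_hasRationalSingularity` (typer of
`Resolution/RationalResolutionSubschemeH1Vanishing`) carries Lipman (1.2) as the binder `h12`; with
`Lipman12B.hasTrivialCechH1_of_isResolution_of_hasRationalSingularity` (this hand, from `Lipman1969_1_2_B_holds`) it is
unconditional at every universe:

* `hasTrivialCechH1_subschemeι_comp_holds` — `S` a two-dimensional normal Noetherian local domain with a rational
  singularity, `π : X → Spec S` any desingularization, `𝓘` any ideal sheaf on `X` ⇒ `H¹(𝒪_{V(𝓘)}) = 0`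
  (`HasTrivialCechH1 (𝓘.subschemeι ≫ π)`); this is what makes `h0 π 𝓘 = χ(𝒪_{V(𝓘)})` in the `h⁰`-renderings of
  Lipman (27.1)/(27.3)/(13.1).

No crux or summit statement is proved here.
-/

noncomputable section

-- single-problem summit: the doubled namespace component `ResolutionOfSingularities` is forced
set_option linter.dupNamespace false

open CategoryTheory AlgebraicGeometry TopologicalSpace IsLocalRing
open Literature.AlgebraicGeometry.Resolution Literature.AlgebraicGeometry.Morphisms

universe u

namespace Summit.ResolutionOfSingularities.ResolutionOfSingularities.Theorems.NoZeno.Lipman12B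

/-- **`H¹(𝒪_Z) = 0` for every closed subscheme `Z = V(𝓘)` of every desingularization of a rational surface
singularity — unconditional.** [cite: Lipman1969, Section 27 (p. 276) with Proposition (1.2) 2) (p. 199)] -/
theorem hasTrivialCechH1_subschemeι_comp_holds
    {S : Type u} [CommRing S] [IsNoetherianRing S] [IsLocalRing S] [IsDomain S] [IsIntegrallyClosed S]
    (hdim : ringKrullDim S = 2) (hrat : HasRationalSingularity S)
    {X : Scheme.{u}} (π : X ⟶ Spec (.of S)) (hπ : IsResolution π) (𝓘 : X.IdealSheafData) :
    HasTrivialCechH1 (𝓘.subschemeι ≫ π) := by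
  haveI : IsIntegral X := hπ.isIntegral_source
  haveI : IsProper π := hπ.isProper
  haveI : IsLocallyNoetherian X := LocallyOfFiniteType.isLocallyNoetherian π
  exact hπ.hasTrivialCechH1_subschemeι_comp π hdim
    (hasTrivialCechH1_of_isResolution_of_hasRationalSingularity hdim hrat π hπ) 𝓘

end Summit.ResolutionOfSingularities.ResolutionOfSingularities.Theorems.NoZeno.Lipman12B

end
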